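import Literature.MathematicalPhysics.QuantumLattice.HubbardNNNHoppingTorusLimitCorrelator
import Literature.MathematicalPhysics.QuantumLattice.FermionTorusTranslationSums
import Literature.MathematicalPhysics.QuantumLattice.PairFieldMomentum
import Literature.MathematicalPhysics.QuantumLattice.LocalPairOn
import Literature.MathematicalPhysics.QuantumLattice.DWaveSourceWindowHamiltonian
import HarnessLib

/-!
# One-point witness, auxiliary lattice facts: spin-resolved charge of the pair field, the pair-field
# expectation as a translation average, and the translations-only orbit state

HONEST FRAMING: first certified bounds on pairing observables; not a superconductivity verdict. Crew
hubbard-obs (D-0042), seat hubbard-obs-p1 (`prover-hubbard-obs-p1-g4-0`). Zero compute; no definition,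
no named fact, no `sorry`. Helpers for `PairLROOnePointCeiling.lean` (the reading `liminf u_k ≤ 2M²` of a
certified one-point ceiling):

* `spinNumber_commutator_pairField` — `[N_σ, Δ_g] = −Δ_g` (`N_σ = ½N ± S^z`); `spinNumber_isHermitian`,
  `spinNumber_mul_totalNumber_comm`;
* `torusAvgExpectAt_localPairAt_eq_expect_pairField_div` — the translation-averaged expectation of the
  local pair at the origin is `⟨ζ, Δ_g ζ⟩/L²` (so a window row on `Φ₀` reads the pair field per site);
* `re_orbitState_spaceGroupUnitary_singleton_one` — with the trivial point group `S = {1}` the orbit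
  state of a torus vector evaluates an embedded window observable by its plain translation average.

References: D. J. Scalapino, Phys. Rep. 250 (1995) 329, §2 eq. (2.2); H. Tasaki, *Physics and
Mathematics of Quantum Many-Body Systems* (2020) §9.3.1; O. Bratteli, D. W. Robinson, *Operator
Algebras and Quantum Statistical Mechanics 2* (1997) §6.2.4; H. Araki, H. Moriya, Rev. Math. Phys. 15
(2003) 93, §4.1.
-/

noncomputable section

open Matrix Complex Finset
open Literature.Probability.LatticeModels
open Literature.MathematicalPhysics.QuantumManyBody.StateRelaxation
open scoped ComplexOrder ComplexConjugate BigOperators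

namespace Summit.Ventures.CertifiedManyBodySolver.Observables

open Literature.MathematicalPhysics.QuantumLattice HubbardWave0

/-! ### Finite-torus helpers -/

section Finite

variable {L : ℕ} [NeZero L] (g : Site 2 → ℝ)

/-- `S^z` commutes with the pair field (singlet pairs). [cite: Scalapino1995, §2 eq. (2.2)] -/
theorem spinZ_commute_pairField : Commute (spinZ : Matrix (Finset (Orb (FermionTorus 2 L))) _ ℂ) (pairField g L) :=
  Commute.sum_right _ _ _ fun x _ => spinZ_commute_localPair g L x

/-- The spin-resolved particle number lowers by one across the pair field: `[N_σ, Δ_g] = −Δ_g`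
(`N_σ = ½N ± S^z`, `[N, Δ_g] = −2Δ_g`, `[S^z, Δ_g] = 0`). [cite: Scalapino1995, §2 eq. (2.2)] -/
theorem spinNumber_commutator_pairField (σ : Fin 2) :
    (∑ y : FermionTorus 2 L, numberOp y σ) * pairField g L - pairField g L * (∑ y : FermionTorus 2 L, numberOp y σ) =
      ((-1 : ℝ) : ℂ) • pairField g L := by
  rw [sum_numberOp_eq_half_totalNumber_add_spinZ]
  have hN : totalNumber * pairField g L - pairField g L * totalNumber = ((-2 : ℝ) : ℂ) • pairField g L := by
    have h : totalNumber * pairField g L - pairField g L * totalNumber = (-2 : ℂ) • pairField g L := by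
      unfold pairField
      exact commutator_sum_eq_smul _ _ _ _ fun x _ => totalNumber_commutator_localPair g L x
    rw [h]; push_cast; rfl
  have hS : (spinZ : Matrix (Finset (Orb (FermionTorus 2 L))) _ ℂ) * pairField g L - pairField g L * spinZ = 0 :=
    sub_eq_zero.2 (spinZ_commute_pairField g).eq
  set s : ℂ := (if σ = 0 then (1 : ℂ) else -1) with hs
  calc ((1 / 2 : ℂ) • (totalNumber : Matrix (Finset (Orb (FermionTorus 2 L))) _ ℂ) + s • spinZ) * pairField g L -
        pairField g L * ((1 / 2 : ℂ) • totalNumber + s • spinZ)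
      = (1 / 2 : ℂ) • (totalNumber * pairField g L - pairField g L * totalNumber) +
          s • ((spinZ : Matrix (Finset (Orb (FermionTorus 2 L))) _ ℂ) * pairField g L - pairField g L * spinZ) := by
        rw [Matrix.add_mul, Matrix.mul_add, Matrix.smul_mul, Matrix.smul_mul, Matrix.mul_smul, Matrix.mul_smul,
          smul_sub, smul_sub]
        abel
    _ = ((-1 : ℝ) : ℂ) • pairField g L := by
        rw [hN, hS, smul_zero, add_zero, smul_smul]
        congr 1
        push_cast
        ring

omit [NeZero L] in
/-- `N_σ` commutes with the total particle number. [cite: Tasaki2020, §9.3.1] -/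
theorem spinNumber_mul_totalNumber_comm (σ : Fin 2) :
    (∑ y : FermionTorus 2 L, numberOp y σ) * (totalNumber : Matrix (Finset (Orb (FermionTorus 2 L))) _ ℂ) =
      totalNumber * (∑ y : FermionTorus 2 L, numberOp y σ) := by
  rw [sum_numberOp_eq_half_totalNumber_add_spinZ, Matrix.add_mul, Matrix.mul_add, Matrix.smul_mul,
    Matrix.mul_smul, Matrix.smul_mul, Matrix.mul_smul, spinZ_commute_totalNumber.eq]

omit [NeZero L] in
/-- `N_σ` is Hermitian. [cite: Tasaki2020, §9.3.1] -/
theorem spinNumber_isHermitian (σ : Fin 2) :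
    (∑ y : FermionTorus 2 L, numberOp y σ : Matrix (Finset (Orb (FermionTorus 2 L))) _ ℂ).IsHermitian := by
  rw [sum_numberOp_eq_half_totalNumber_add_spinZ]
  refine Matrix.IsHermitian.add ?_ ?_
  · exact totalNumber_isHermitian.smul (by rw [isSelfAdjoint_iff]; norm_num [Complex.ext_iff])
  · refine HubbardWave0.spinZ_isHermitian.smul ?_
    split_ifs <;> rw [isSelfAdjoint_iff] <;> norm_num

/-- **The translation-averaged expectation of the local pair is the pair-field expectation per site**:
`torusAvgExpectAt L (pairRegion S_d 0) (localPairAt S_d g 0) ζ = ⟨ζ, Δ_g ζ⟩/L²`.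
[cite: Scalapino1995, §2 eq. (2.2)] -/
theorem torusAvgExpectAt_localPairAt_eq_expect_pairField_div
    (h : Set.InjOn (Torus.proj (d := 2) L) ↑(pairRegion (insert (0 : Site 2) unitSteps) 0))
    (ζ : Fock (Orb (FermionTorus 2 L))) :
    torusAvgExpectAt L (pairRegion (insert (0 : Site 2) unitSteps) 0) (localPairAt (insert (0 : Site 2) unitSteps) g 0) ζ =
      expect (pairField g L) ζ / ((L : ℂ) ^ 2) := by
  have hL : ((L : ℂ) ^ 2) ≠ 0 := pow_ne_zero 2 (Nat.cast_ne_zero.2 (NeZero.ne L))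
  -- the pair field is the translation sum of the embedded local pair
  have hP : pairField g L = ∑ v : TorusSite 2 L, relabel (Orb.translate v)
      (fermionEmbed (PolySite.toTorusEmb L h) (localPairAt (insert (0 : Site 2) unitSteps) g 0)) := by
    rw [fermionEmbed_toTorusEmb_localPairAt L _ g 0 h, localPairOn_insert_zero_unitSteps]
    have h0 : Torus.proj L (0 : Site 2) = (0 : TorusSite 2 L) := by funext i; simp [Torus.proj]
    simp_rw [h0, relabel_translate_localPair, zero_add]
    rfl
  rw [eq_div_iff hL, mul_comm, ← expect_sum_relabel_translate_fermionEmbed' L h, ← hP]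

/-- A region lies inside its trivial affine image `1·Λ + 0`. [folklore] -/
theorem subset_d4ShiftSet_one_zero' (Λ : Finset (Site 2)) : Λ ⊆ d4ShiftSet 1 0 Λ := by
  intro x hx
  have h := d4Vec_add_mem_d4ShiftSet (1 : DihedralGroup 4) (0 : Site 2) hx
  rwa [d4Vec_one, add_zero] at h

/-- `Γ(d4Emb 1 0 Λ) = Γ(incl)` on operators (the trivial affine map is the inclusion `Λ ⊆ 1·Λ + 0`).
[cite: ArakiMoriya2003, §4.1 Def. 4.1 (2)] -/
theorem fermionEmbed_d4Emb_one_zero' {Λ : Finset (Site 2)} (A : FermionOp Λ) :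
    fermionEmbed (PolySite.d4Emb 1 0 Λ) A = fermionEmbed (PolySite.incl (subset_d4ShiftSet_one_zero' Λ)) A := by
  refine congrFun (congrArg DFunLike.coe (fermionEmbed_congr fun y => ?_)) A
  refine Subtype.ext ?_
  show toLex (d4Vec 1 (ofLex y.1) + 0) = y.1
  rw [d4Vec_one, add_zero]
  rfl

/-- **Translations only**: the orbit state over `(U_v D_1)_v` of a torus vector `ζ` evaluates an embedded
window observable by its plain translation average, `Re ω̄_ζ(Γ(ι_{Λ'}) X) = Re torusAvgExpectAt L Λ' X ζ`.
[cite: BratteliRobinsonII1997, §6.2.4] -/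
theorem re_orbitState_spaceGroupUnitary_singleton_one {Λ' : Finset (Site 2)}
    (hInj' : Set.InjOn (Torus.proj (d := 2) L) ↑Λ') (Xw : FermionOp Λ') (ζ : Fock (Orb (FermionTorus 2 L))) :
    (orbitState (spaceGroupUnitary ({1} : Finset (DihedralGroup 4))) ζ (fermionEmbed (PolySite.toTorusEmb L hInj') Xw)).re =
      (torusAvgExpectAt L Λ' Xw ζ).re := by
  have hInj1 : Set.InjOn (Torus.proj (d := 2) L) ↑(d4ShiftSet 1 0 Λ') := (injOn_proj_d4ShiftSet_iff L 1 0 Λ').2 hInj'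
  rw [re_orbitState_spaceGroupUnitary_fermionEmbed_toTorusEmb ({1} : Finset (DihedralGroup 4)) hInj' Xw ζ,
    Finset.sum_singleton, Finset.card_singleton, Nat.cast_one, inv_one, one_mul, fermionEmbed_d4Emb_one_zero',
    torusAvgExpectAt_fermionEmbed_incl L (subset_d4ShiftSet_one_zero' Λ') hInj1]

end Finite


end Summit.Ventures.CertifiedManyBodySolver.Observables

end
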